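import Mathlib
import Summits.KontsevichZagierPeriods.Zeta5Search.ClusterValuationPairs
import HarnessLib

/-!
# ζ(5) search — MIXED PAIRS of the `𝒦`-bracket and the palindromic `𝒦`-class bound (gen-2 g9 for typer g9's (CV-𝒦) assembly)

Cell `pub-zeta5` (HONEST FRAMING: systematic search; no irrationality claim unless certified), gen-2 ideation seat generation 9,
REPORT-gen2-g9 §11.  STATEMENTS ONLY (`@[conjecture]`, audited vocabulary of `ClusterValuation{,Pairs}`; `p`-adic valuations of rational
numbers, nothing about irrationality).  Typer g9 (INBOX 14:30Z) reduces (CV) in the window to (CV-𝒦) and plans (CV-𝒦) ⇐ `MultiBlockLaw` +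
`SingleRowLaw` + a MIXED-PAIR reduction, asking gen-2 for the exact form of gen-2 g8's mixed-pair bound "`v(B_xy) ≥ 3 + E_x + {0, −s_y}`"
(REPORT-gen2-g8 §3.1(b)).  The exact form, with the tree's own vocabulary, is: for a multipole class `x` and a single-pole class `y`,
  `v(B_xy) ≥ 3 + E_x + ν_y`,  `B_xy := 𝒦_x(b⁺)V_y(b) − 𝒦_x(b)V_y(b⁺)`,  `ν_y = classNu b p y` (`max(E_y,0)` if `y` is tame, `E_y` otherwise —
g8's `{0, −s_y}` is `{tame, non-tame without zeros}`; a non-tame class with zeros above its pole has `ν_y = E_y = −s_y + #zeros`),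
termwise from `v(𝒦_x) ≥ 3 + E_x` (Theorem A + `p² ∣ g₀`, `p ∣ g_o − [o=2]`), `v(V_y) ≥ ν_y` (V1/V2) and the monotonicity `E_x(b⁺) ≥ E_x(b)`,
`ν_y(b⁺) ≥ ν_y(b)` under `b⁺ = b + e_j` (a block loses its two end points); and the ONE missing unit in the 0.3 % of pairs where
`3 + E_x + ν_y = target − 1` (`target = refund − N_p`) is ALWAYS supplied by the PALINDROME BONUS of the `𝒦`-class: `x` palindromic with `E_x`
even `≤ −4` has `v(𝒦_x) ≥ 4 + E_x` (`PalindromicClassKBound` below = Lemma S `SymmetricClassKBound` generalised from the two-point shapes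
`(−a,−a)` to every palindromic configuration, self-conjugate or not, with the tree's `classBound b p x 3`; paper proof: U-K `KDigit` + `CHatReversal`
+ translation invariance of `ĉ` from `RhoResidueIdentities`, all modulo Theorem B).
EVIDENCE (exact rationals, `g9/mixedpair_check.py`, `g9/palink_tree_check.py`; logs `g9/mixedpair_seed7.log`, `g9/palink_tree_seed6.log`): random
`b` in the polytope, `b₀ ≤ 48`, window primes `p ≤ b₀`: 97,844 mixed pairs — termwise bound 97,844/97,844, `v(B_xy) ≥ target` 97,844/97,844,
bound-level inequality `MixedPairBoundLevel` 97,844/97,844 (without the palindromic unit it fails 338 times), monotonicity 97,416 + 97,844 / same;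
`PalindromicClassKBound` 20,883/20,883 multipole classes with `E_x ≤ −3` (bonus attained with equality in 2,798 of the 3,206 bonus classes; the
bound FAILS at `E_x = −2`, 663 classes — the Fermat-quotient term of U-K — hence the hypothesis `E_x ≤ −3`).  CONJECTURES with exact finite evidence.
-/

open Finset

namespace Summit.KontsevichZagierPeriods.Zeta5Search.ClusterValuation

open Summit.KontsevichZagierPeriods.Zeta5Search.WedgeDictionary (pfData dOf)
open Summit.KontsevichZagierPeriods.Zeta5Search.CasoratianValuation (InPolytope shift casoratian refund pairFloors)

/-- **PALINDROMIC `𝒦`-CLASS BOUND (gen-2 g9; generalises Lemma S `SymmetricClassKBound`; PROVED on paper modulo Theorem B from `KDigit` +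
`CHatReversal` + `RhoResidueIdentities`)**: a multipole class with `E_x ≤ −3` has `v(𝒦_x) ≥ classBound b p x 3 = 3 + E_x + [configuration
palindromic ∧ E_x even]`.  (False at `E_x = −2`.)  Exact check 20,883/20,883. -/
@[conjecture] def PalindromicClassKBound : Prop :=
  ∀ (b : ℕ → ℤ) (p x : ℕ), InPolytope b → p.Prime → 5 ≤ p → (p : ℤ) ≤ b 0 → (b 0 + 2 : ℤ) < (p : ℤ) ^ 2 → x < p →
    2 ≤ classPoleCount b p x → classExp b p x ≤ -3 → classK b p x ≠ 0 →
      classBound b p x 3 ≤ padicValRat p (classK b p x)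

/-- The palindromic unit of a multipole class as used for mixed pairs: `1` iff the configuration is palindromic, `E_x` even and `E_x ≤ −4`. -/
def palUnit (b : ℕ → ℤ) (p x : ℕ) : ℤ :=
  if IsPalindromic (classConfig b p x) ∧ Even (classExp b p x) ∧ classExp b p x ≤ -4 then 1 else 0

/-- **MIXED-PAIR BOUND-LEVEL INEQUALITY (gen-2 g9; pure class combinatorics, decidable per instance; OBSERVED 97,844/97,844, paper proof
not written)**: for a multipole class `x` and a single-pole class `y`, `refund − N_p ≤ 3 + E_x + ν_y + palUnit`. -/
@[conjecture] def MixedPairBoundLevel : Prop :=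
  ∀ (b : ℕ → ℤ) (p x y : ℕ), InPolytope b → p.Prime → 5 ≤ p → (p : ℤ) ≤ b 0 → (b 0 + 2 : ℤ) < (p : ℤ) ^ 2 → x < p → y < p →
    2 ≤ classPoleCount b p x → classPoleCount b p y = 1 →
      refund b p - pairFloors b p ≤ 3 + classExp b p x + classNu b p y + palUnit b p x

/-- **MIXED-PAIR LAW (gen-2 g9; = `MixedPairBoundLevel` + termwise bound + `PalindromicClassKBound`; OBSERVED 97,844/97,844 and gen-2 g8's
0 mixed pairs below target in 1,128 `(b,p)`)**: every mixed pair of the `𝒦`-bracket reaches the (CV-𝒦) target `refund − N_p`. -/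
@[conjecture] def MixedPairLaw : Prop :=
  ∀ (b : ℕ → ℤ) (j p x y : ℕ), InPolytope b → 1 ≤ j → j ≤ 7 → InPolytope (shift b j) →
    p.Prime → 5 ≤ p → (p : ℤ) ≤ b 0 → (b 0 + 2 : ℤ) < (p : ℤ) ^ 2 → x < p → y < p →
    2 ≤ classPoleCount b p x → classPoleCount b p y = 1 →
      classK (shift b j) p x * classV b p y - classK b p x * classV (shift b j) p y ≠ 0 →
        refund b p - pairFloors b p ≤ padicValRat p (classK (shift b j) p x * classV b p y - classK b p x * classV (shift b j) p y)

/-- **TERMWISE MIXED-PAIR BOUND (gen-2 g9; PROVED on paper from Theorem A, V1/V2 and monotonicity under `e_j`)**. -/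
@[conjecture] def MixedPairTermwise : Prop :=
  ∀ (b : ℕ → ℤ) (j p x y : ℕ), InPolytope b → 1 ≤ j → j ≤ 7 → InPolytope (shift b j) →
    p.Prime → 5 ≤ p → (p : ℤ) ≤ b 0 → (b 0 + 2 : ℤ) < (p : ℤ) ^ 2 → x < p → y < p →
    2 ≤ classPoleCount b p x → classPoleCount b p y = 1 →
      classK (shift b j) p x * classV b p y - classK b p x * classV (shift b j) p y ≠ 0 →
        3 + classExp b p x + classNu b p y + palUnit b p x ≤
          padicValRat p (classK (shift b j) p x * classV b p y - classK b p x * classV (shift b j) p y)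

/-! ### Sanity instance: a pair that needs the palindromic unit -/

/- `b = (20; 10,7,7,3,3,3,2)`, `p = 11`, `x = 3` (configuration `(−3,−3)`, `E_x = −6`), `y = 2` (configuration `(0,−5)`, non-tame, `ν_y = −5`):
`refund − N_p = −7 = 3 − 6 − 5 + 1`. -/
/- The sanity vector is written out literally in each conjunct (neither a `def` — audit `tree.orphan` — nor a `local notation` —
gate lint `declares notation`; lead-lane filing note, lit g8). -/
example :
    classPoleCount (fun i : ℕ => List.getD ([20, 10, 7, 7, 3, 3, 3, 2] : List ℤ) i 0) 11 3 = 2 ∧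
    classExp (fun i : ℕ => List.getD ([20, 10, 7, 7, 3, 3, 3, 2] : List ℤ) i 0) 11 3 = -6 ∧
    classPoleCount (fun i : ℕ => List.getD ([20, 10, 7, 7, 3, 3, 3, 2] : List ℤ) i 0) 11 2 = 1 ∧
    classNu (fun i : ℕ => List.getD ([20, 10, 7, 7, 3, 3, 3, 2] : List ℤ) i 0) 11 2 = -5 ∧
    refund (fun i : ℕ => List.getD ([20, 10, 7, 7, 3, 3, 3, 2] : List ℤ) i 0) 11
      - pairFloors (fun i : ℕ => List.getD ([20, 10, 7, 7, 3, 3, 3, 2] : List ℤ) i 0) 11 = -7 ∧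
    palUnit (fun i : ℕ => List.getD ([20, 10, 7, 7, 3, 3, 3, 2] : List ℤ) i 0) 11 3 = 1 := by
  set_option maxRecDepth 40000 in decide

end Summit.KontsevichZagierPeriods.Zeta5Search.ClusterValuation
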